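import Summits.CriticalPhenomena.PercolationContinuityZ3.Theorems.PercLowPointHalfSpaceTallClusterMassBoundOnesidedHalvesGlue
import Summits.CriticalPhenomena.PercolationContinuityZ3.Theorems.PercLowPointHalfSpaceTallClusterMassBoundOnesidedHalvesNoFatForms
import Summits.CriticalPhenomena.PercolationContinuityZ3.Theorems.PercLowPointHalfSpaceTallClusterMassBoundOnesidedHalvesTypicalMaxGrowthForms
import Summits.CriticalPhenomena.PercolationContinuityZ3.Theorems.PercLowPointHalfSpaceTallClusterMassBoundWallArmDoublingEquiv

/-!
# Line `onesided-halves` for crux B `TallClusterMassBound` (stmt-CriticalPhenomena-0912) — skeleton (rev 3: thin, over LANDED glue)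

Rev 3 (line lead c7, 2026-08-17): the three registered stubs are UNCHANGED (names + signatures verbatim as in rev 2,
crux-strategist 2026-08-17T03:03Z); everything else of rev 2 is now LANDED in `Theorems/` and imported:

* glue `…Theorems.PercLowPointHalfSpaceTallClusterMassBoundOnesidedHalvesGlue` (p140915): `typicalMax_le_of_noFat`,
  `exists_bandRatio`, `volTail_band_step`, `wallVolumeRadiusRatio_of_growth_of_regular` (V ⟸ G ∧ D),
  `tallClusterMassBound_of_noFat_of_volRad` (B ⟸ B♯ ∧ V, k = 2 split glue, route vocabulary),
  `tallClusterMassBound_of_noFat_of_growth_of_regular` (B ⟸ B♯ ∧ G ∧ D, the stubs verbatim) and `…_route` (k = 3 split glue,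
  route vocabulary — the `--glue-by` declaration for the prepared split);
* reshaped forms of the stubs (all `↔`, landed): B♯ ↔ `typicalMax P^ℍ Λ_n ≤ C n^{11/4}` (`noFatHalfBoxOrigin_iff_typicalMax_le`,
  p141273) and B♯ ⟸ stmt-CriticalPhenomena-11506 VERBATIM (`stub_noFatHalfBoxOrigin_of_squareSubharmonic`, p141273 over p136366);
  G ↔ fixed-ratio doubling of the typical max ↔ the MERGING estimate, also in eventual form
  (`typicalMaxPolyGrowth_iff_fixedRatio`/`_iff_merging`, p142383; `_iff_eventually_fixedRatio`/`_iff_eventually_merging`, p143072;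
  first slice `typicalMax_halfBox_linear_lower` M(Λ_r) ≥ r/96, p142385; lateral invariance + per-translate lower tail, p142848);
  D ↔ uniform wall-arm doubling with SOME q₀ > 0 (`wallArmPolyRegular_iff_doubling`, p140973; eventual form
  `wallArmPolyRegular_iff_eventually_doubling`, p143489).

What remains OPEN is exactly the three stubs, each crux-sized (wave 1 verdicts): B♯ `stub-blocked` on the existing open crux
stmt-CriticalPhenomena-11506 (`SquareSubharmonic`; no other feeder in the tree); G `stub-blocked: none` — missing MERGING of
macroscopic clusters of laterally adjacent half-boxes at `p_c(ℤ³)` (hyperscaling / uniqueness-of-macroscopic-clusters class);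
D `stub-blocked: none` — uniform wall-arm extension (Kesten 1986 (6) on the wall of `ℤ³`, RSW/gluing class). The composition
`tallClusterMassBound_holds_modulo_stubs` is the landed k = 3 glue applied to the three stubs, so `lean check`'s audit sees the
crux concluded BY NAME modulo exactly the stubs; the prepared route split (strategist `children3.json`) can cite
`Summit.CriticalPhenomena.PercolationContinuityZ3.Theorems.TallClusterMassBound.OnesidedHalves.tallClusterMassBound_of_noFat_of_growth_of_regular_route`.

Honours `tallClusterMassBound_false_without_criticality` (Disproof §3): `p ≤ p_c` enters only `stub_noFatHalfBoxOrigin`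
(false at `p = 1`); G, D hold at `p = 1`. Disproof.lean sha 3c599212… unchanged, `-- Targets`: none.
-/

noncomputable section

open MeasureTheory Finset Filter Topology
open Literature.Probability.Percolation Literature.Probability.LatticeModels
open Summit.CriticalPhenomena.PercolationContinuityZ3.Theses.PercLowPointHalfSpace (TallClusterMassBound)
open Summit.CriticalPhenomena.PercolationContinuityZ3.Theses.PercSubharmonicSquare (SquareSubharmonic)
open Summit.CriticalPhenomena.PercolationContinuityZ3.Theorems.TallClusterMassBound.Negative

namespace Summit.CriticalPhenomena.PercolationContinuityZ3.Cruxes.TallClusterMassBound.OnesidedHalves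

/-! ## The three registered stubs -/

/-- **Stub 1 (B♯ = `NoFatHalfBoxOrigin`, the `p ≤ p_c` half).** At `p_c(ℤ³)`, for bond percolation on the induced
half-space, `P^ℍ_{p_c}(|K_max(B_n ∩ ℍ)| ≥ C n^{11/4}) ≤ e^{-1}` for all `n ≥ 1`. Verbatim the registered stub
`stub_noFatHalfBoxOrigin` of stmt-CriticalPhenomena-14713; ⟸ stmt-CriticalPhenomena-11506 (p136366). OPEN (crux-sized). -/
theorem stub_noFatHalfBoxOrigin :
    ∃ C : ℝ, 0 < C ∧ ∀ n : ℕ, 1 ≤ n → (Literature.Probability.Percolation.floorDilutedPercolation 3 (Literature.Probability.Percolation.criticalProbI 3) 1).real {ω | C * (n : ℝ) ^ ((11 : ℝ) / 4) ≤ (Literature.Probability.Percolation.clusterMaxIn ((Literature.Probability.LatticeModels.box 3 n).filter fun z : Literature.Probability.LatticeModels.Site 3 => 0 ≤ z 0) ω : ℝ)} ≤ Real.exp (-1) := by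
  sorry

/-- **Stub 2 (G = `TypicalMaxPolyGrowth`, `p ≥ p_c`-type).** Polynomial LOWER growth of Hutchcroft's typical max of the
largest cluster trace of induced half-space percolation at `p_c(ℤ³)` in the half-boxes `Λ_r = B_r ∩ ℍ`:
`c (r/ρ)^κ · typicalMax Λ_ρ ≤ typicalMax Λ_r` for all `1 ≤ ρ ≤ r`, for SOME `c, κ > 0`. OPEN (crux-sized; hyperscaling class,
lower-bound side). -/
theorem stub_typicalMaxPolyGrowth :
    ∃ c κ : ℝ, 0 < c ∧ 0 < κ ∧ ∀ ρ r : ℕ, 1 ≤ ρ → ρ ≤ r →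
      c * ((r : ℝ) / ρ) ^ κ * (typicalMax (floorDilutedPercolation 3 (criticalProbI 3) 1) (halfBox ρ) : ℝ) ≤
        typicalMax (floorDilutedPercolation 3 (criticalProbI 3) 1) (halfBox r) := by
  sorry

/-- **Stub 3 (D = `WallArmPolyRegular`, `p ≥ p_c`-type).** Polynomial regularity of the wall one-arm probability at `p_c(ℤ³)`:
`π_s(ρ) ≤ C (r/ρ)^μ π_s(r)` for all `1 ≤ ρ ≤ r`, for SOME `C, μ` — equivalently, uniform doubling `π_s(2n) ≥ q₀ π_s(n)` for
SOME `q₀ > 0`. OPEN (crux-sized; RSW class, constant-free form). -/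
theorem stub_wallArmPolyRegular :
    ∃ C μ : ℝ, ∀ ρ r : ℕ, 1 ≤ ρ → ρ ≤ r →
      armProb (criticalProbI 3) ρ ≤ C * ((r : ℝ) / ρ) ^ μ * armProb (criticalProbI 3) r := by
  sorry

/-! ## The reshaped targets (landed equivalences; documentation for the next seat / the planner) -/

/-- B♯ ⟸ stmt-CriticalPhenomena-11506 verbatim (landed feeder, p141273 over p136366): the stub closes by this line the
day `SquareSubharmonic` is proved. [folklore] -/
theorem stub_noFatHalfBoxOrigin_of_squareSubharmonic (h : SquareSubharmonic) :
    ∃ C : ℝ, 0 < C ∧ ∀ n : ℕ, 1 ≤ n → (Literature.Probability.Percolation.floorDilutedPercolation 3 (Literature.Probability.Percolation.criticalProbI 3) 1).real {ω | C * (n : ℝ) ^ ((11 : ℝ) / 4) ≤ (Literature.Probability.Percolation.clusterMaxIn ((Literature.Probability.LatticeModels.box 3 n).filter fun z : Literature.Probability.LatticeModels.Site 3 => 0 ≤ z 0) ω : ℝ)} ≤ Real.exp (-1) :=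
  Summit.CriticalPhenomena.PercolationContinuityZ3.Theorems.TallClusterMassBound.OnesidedHalves.stub_noFatHalfBoxOrigin_of_squareSubharmonic h

/-- B♯ ↔ `typicalMax P^ℍ_{p_c} Λ_n ≤ C n^{11/4}` (landed, p141273). [folklore] -/
theorem stub_noFatHalfBoxOrigin_iff_typicalMax_le :
    (∃ C : ℝ, 0 < C ∧ ∀ n : ℕ, 1 ≤ n → (Literature.Probability.Percolation.floorDilutedPercolation 3 (Literature.Probability.Percolation.criticalProbI 3) 1).real {ω | C * (n : ℝ) ^ ((11 : ℝ) / 4) ≤ (Literature.Probability.Percolation.clusterMaxIn ((Literature.Probability.LatticeModels.box 3 n).filter fun z : Literature.Probability.LatticeModels.Site 3 => 0 ≤ z 0) ω : ℝ)} ≤ Real.exp (-1)) ↔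
    (∃ C : ℝ, ∀ n : ℕ, 1 ≤ n → (typicalMax (floorDilutedPercolation 3 (criticalProbI 3) 1) (halfBox n) : ℝ) ≤ C * (n : ℝ) ^ ((11 : ℝ) / 4)) :=
  Summit.CriticalPhenomena.PercolationContinuityZ3.Theorems.TallClusterMassBound.OnesidedHalves.noFatHalfBoxOrigin_iff_typicalMax_le

/-- G ↔ the MERGING estimate: for some fixed `L ≥ 2` and all `r ≥ 1`, with `P^ℍ_{p_c}`-probability `> e^{-1}` ONE open
cluster has `≥ 2 M(Λ_r) − 1` vertices in `Λ_{Lr}` (landed, p142383; the eventual form `…_iff_eventually_merging`, only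
`r ≥ r₀`, is p143072). This is the exact missing engine of the line on G's side. [folklore] -/
theorem stub_typicalMaxPolyGrowth_iff_merging :
    (∃ c κ : ℝ, 0 < c ∧ 0 < κ ∧ ∀ ρ r : ℕ, 1 ≤ ρ → ρ ≤ r →
      c * ((r : ℝ) / ρ) ^ κ * (typicalMax (floorDilutedPercolation 3 (criticalProbI 3) 1) (halfBox ρ) : ℝ) ≤
        typicalMax (floorDilutedPercolation 3 (criticalProbI 3) 1) (halfBox r)) ↔
    (∃ L : ℕ, 2 ≤ L ∧ ∀ r : ℕ, 1 ≤ r →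
      Real.exp (-1) < (floorDilutedPercolation 3 (criticalProbI 3) 1).real
        {ω | 2 * typicalMax (floorDilutedPercolation 3 (criticalProbI 3) 1) (halfBox r) - 1 ≤
          clusterMaxIn (halfBox (L * r)) ω}) :=
  Summit.CriticalPhenomena.PercolationContinuityZ3.Theorems.TallClusterMassBound.OnesidedHalves.typicalMaxPolyGrowth_iff_merging

/-- D ↔ uniform wall-arm doubling with SOME constant `q₀ > 0` at `p_c(ℤ³)` (landed, p140973; eventual form p143489).
[folklore] -/
theorem stub_wallArmPolyRegular_iff_doubling :
    (∃ C μ : ℝ, ∀ ρ r : ℕ, 1 ≤ ρ → ρ ≤ r →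
      armProb (criticalProbI 3) ρ ≤ C * ((r : ℝ) / ρ) ^ μ * armProb (criticalProbI 3) r) ↔
    (∃ q₀ : ℝ, 0 < q₀ ∧ ∀ n : ℕ, 1 ≤ n →
      q₀ * armProb (criticalProbI 3) n ≤ armProb (criticalProbI 3) (2 * n)) :=
  Summit.CriticalPhenomena.PercolationContinuityZ3.Theorems.TallClusterMassBound.OnesidedHalves.wallArmPolyRegular_iff_doubling

/-! ## Composition (landed glue applied to the three stubs) -/

/-- The crux from the three stubs, through the LANDED k = 3 glue
`Theorems…OnesidedHalves.tallClusterMassBound_of_noFat_of_growth_of_regular` (p140915), so that `lean check`'s audit sees the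
item concluded BY NAME modulo exactly the stubs. -/
theorem tallClusterMassBound_holds_modulo_stubs :
    Summit.CriticalPhenomena.PercolationContinuityZ3.Theses.PercLowPointHalfSpace.TallClusterMassBound :=
  Summit.CriticalPhenomena.PercolationContinuityZ3.Theorems.TallClusterMassBound.OnesidedHalves.tallClusterMassBound_of_noFat_of_growth_of_regular
    stub_noFatHalfBoxOrigin stub_typicalMaxPolyGrowth stub_wallArmPolyRegular

end Summit.CriticalPhenomena.PercolationContinuityZ3.Cruxes.TallClusterMassBound.OnesidedHalves

end
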